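import Summits.HodgeConjecture.HodgeConjecture.Theorems.NoetherLefschetzOneUpK3TypeNetsSurfaceProductsUnequalRank
import Summits.HodgeConjecture.HodgeConjecture.Theorems.NoetherLefschetzOneUpSummitGrantedFourfoldsCohomologicallyAlgebraicTransferSymm

/-!
# Products `S₁ × S₂` with `p_g(S₁) = 1` and a rank gap `b₂(S₂) − ρ(S₂) < b₂(S₁) − ρ(S₁)`

Crux `K3TypeNets` (stmt-HodgeConjecture-11600), product sector, fourth file of gen 48. The previous file
(`…SurfaceProductsUnequalRank`) treats two surfaces with `h^{2,0} = 1`; here the SECOND factor is an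
ARBITRARY smooth projective surface: **if `h^{2,0}(S₁) = 1` and the transcendental lattice
`T(S₂)_ℚ = Hdg¹(S₂)^⊥` has smaller rank than `T(S₁)_ℚ`, i.e. `b₂(S₂) − ρ(S₂) < b₂(S₁) − ρ(S₁)`, then
`Hom_Hdg(T(S₂), T(S₁)) = 0` and the Hodge conjecture holds for `S₁ × S₂` and for `S₂ × S₁`.** Only the
irreducibility of `T(S₁)` is used (Schur: the image of `T(S₂) → T(S₁)` is a sub-Hodge structure of the
irreducible `T(S₁)`, so it is `0` or everything, and it cannot be everything for rank reasons); `T(S₂)`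
need not be irreducible, `S₂` may have any `p_g`, any `b₁`. Examples: a K3 surface `S₁` with
`ρ(S₁) = 1` (rank `21`, granted `b₂ = 22`) times ANY abelian surface, Enriques surface, K3 surface with
`ρ ≥ 2`, or surface with `b₂ − ρ ≤ 20`.

* `Hom.toLinearMap_eq_zero_of_isIrreducible_of_finrank_lt` — Schur with an irreducible TARGET only;
* `exists_transcendental_subHodgeStructure'` — `T(S)_ℚ` underlies a sub-Hodge structure of `H²_B(S)` for
  EVERY smooth projective surface (the tree's abstract `exists_subHodgeStructure_orthogonal_hodgeClasses`);
* `hom_transcendental_eq_zero_of_lt` — the hypothesis `hT₀` of the gen-47 criterion;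
* `hodgeConjectureFor_prod_of_finrank_lt`, `hodgeConjectureFor_prod_of_finrank_lt'` (the swapped product,
  along `S₂ ⊗ S₁ ≅ S₁ ⊗ S₂`), `hodgeConjectureFor_prod_of_isK3Surface_of_finrank_lt` (K3 first factor).

No definition, no named-fact hypothesis, no sorry. Prover seat ring2-b02 (gen 48).

References: D. Huybrechts, *Lectures on K3 Surfaces*, Ch. 3 Lemma 3.1, Lemma 2.7, Lemma 3.3; D. Huybrechts,
*Motives of isogenous K3 surfaces* (2019), §1; C. Voisin, *Hodge Theory and Complex Algebraic Geometry I*,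
§7.3.1 and §11.3.3.
-/

set_option linter.dupNamespace false

noncomputable section

namespace Summit.HodgeConjecture.HodgeConjecture.Theorems.OddPrimeSquares

open scoped TensorProduct
open CategoryTheory MonoidalCategory CartesianMonoidalCategory
open Literature.AlgebraicGeometry Literature.AlgebraicGeometry.Motives
open Literature.AlgebraicGeometry.HodgeTheory Literature.AlgebraicTopology.SingularHomology
open Literature.AlgebraicGeometry.Motives.HodgeStructure Literature.AlgebraicGeometry.Surfaces

/-! ### Schur with an irreducible target -/

section Schur

universe u v

variable {V : Type u} [AddCommGroup V] [Module ℚ V] {W : Type v} [AddCommGroup W] [Module ℚ W] {n : ℤ}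

/-- **Schur's lemma, irreducible target**: a morphism of Hodge structures `φ : H₁ → H₂` into an
IRREDUCIBLE `H₂` from a space of strictly smaller (finite) dimension is zero — its image is a sub-Hodge
structure of `H₂` (`Hom.exists_subHodgeStructure_range`), hence `0` or everything, and `φ` cannot be
surjective. [cite: Huybrechts2016K3, Ch. 3 Lemma 3.3 and §2.2] [cite: VoisinHodgeI2002, §7.3.1] -/
theorem Hom.toLinearMap_eq_zero_of_isIrreducible_of_finrank_lt [Module.Finite ℚ V] [Module.Finite ℚ W]
    {H₁ : HodgeStructure V n} {H₂ : HodgeStructure W n} (h₂ : H₂.IsIrreducible)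
    (hlt : Module.finrank ℚ V < Module.finrank ℚ W) (φ : Hom H₁ H₂) : φ.toLinearMap = 0 := by
  obtain ⟨R, hR⟩ := φ.exists_subHodgeStructure_range
  rcases h₂.eq_bot_or_eq_top R with hRbot | hRtop
  · exact LinearMap.range_eq_bot.1 (hR ▸ hRbot)
  · exfalso
    have hsurj : Function.Surjective φ.toLinearMap := LinearMap.range_eq_top.1 (hR ▸ hRtop)
    exact absurd (LinearMap.finrank_le_finrank_of_surjective hsurj) (not_le.2 hlt)

end Schur

variable {S₁ S₂ : SchemeOver ℂ}

/-- `H²_B(S)`: the weight-two `ℚ`-Hodge structure on `H²(S(ℂ); ℚ)` of the real Hodge model of `S`. -/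
local notation3 "H²[" hS "]" =>
  bettiTwoHodgeStructure hS (BettiUniverse.realHodgeModel exists_isReal_hodgeModel_holds hS)
    (BettiUniverse.realHodgeModel_isHodgeSymmetric exists_isReal_hodgeModel_holds hS)

/-- `T(S)_ℚ = Hdg¹^⊥ ⊆ H²(S(ℂ); ℚ)`. -/
local notation3 "T[" hS "]" =>
  transcendentalLatticeBetti hS (BettiUniverse.realHodgeModel exists_isReal_hodgeModel_holds hS)
    (BettiUniverse.realHodgeModel_isHodgeSymmetric exists_isReal_hodgeModel_holds hS)

/-- `Θ : ℂ ⊗_ℚ H²(S(ℂ); ℚ) → H²(S(ℂ); ℂ)`. -/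
local notation3 "Θ[" S "]" => ofRatClassBaseChange (Motives.ComplexPoints S) (2 * 1)

/-! ### The transcendental lattice of an arbitrary surface is a sub-Hodge structure -/

/-- **`T(S)_ℚ = Hdg¹(S)^⊥` underlies a sub-Hodge structure of `H²_B(S)` for EVERY smooth projective complex
surface** (no hypothesis on `p_g`): the intersection form is non-degenerate and satisfies the first
Hodge–Riemann relation, so the tree's abstract `exists_subHodgeStructure_orthogonal_hodgeClasses` applies.
[cite: Huybrechts2016K3, Ch. 3 Lemma 3.1 (proof)] [cite: VoisinHodgeI2002, §7.3.1 and Lemma 7.30] -/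
theorem exists_transcendental_subHodgeStructure' (hS : IsSmoothProjective 2 S₁) :
    ∃ T : SubHodgeStructure (H²[hS]), T.toSubmodule = T[hS] := by
  haveI : Module.Finite ℚ (bettiCohomology S₁ (2 * 1)) := BettiUniverse.finite hS (2 * 1)
  exact exists_subHodgeStructure_orthogonal_hodgeClasses (cupPairingBetti hS)
    (cupPairingBetti_nondegenerate hS) (hodge_F_apply_eq_zero hS)

/-! ### `Hom_Hdg(T(S₂), T(S₁)) = 0` across a rank gap -/

/-- **`Hom_Hdg(T(S₂), T(S₁)) = 0` when `h^{2,0}(S₁) = 1` and `rk T(S₂) < rk T(S₁)`** (`S₂` ANY smooth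
projective surface) — the hypothesis `hT₀` of `SurfaceProducts.hodgeConjectureFor_prod_of_hom_transcendental_eq_zero`:
every `ℂ`-linear `f : H²(S₂(ℂ); ℂ) → H²(S₁(ℂ); ℂ)` preserving rational classes and Hodge types with image
cup-orthogonal to `N¹H²(S₁)` vanishes on `T(S₂) = (N¹H²(S₂))^⊥`: `f = Θ₁ (g ⊗ ℂ) Θ₂⁻¹` with `g` a
morphism `H²_B(S₂) → H²_B(S₁)` into `T(S₁)_ℚ`; its restriction `T(S₂)_ℚ → T(S₁)_ℚ` has irreducible target
(`exists_transcendental_subHodgeStructure`) of larger rank (`finrank_transcendentalLatticeBetti`), so it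
vanishes (`Hom.toLinearMap_eq_zero_of_isIrreducible_of_finrank_lt`). [cite: Huybrechts2016K3, Ch. 3 Lemma 3.1, Lemma 2.7 and Lemma 3.3]
[cite: Huybrechts2019, §1] -/
theorem hom_transcendental_eq_zero_of_lt (h₁ : IsSmoothProjective 2 S₁) (h₂ : IsSmoothProjective 2 S₂)
    {σ₁ : complexBetti S₁ (2 * 1)} (hσ₁ : IsOfHodgeType 2 S₁ (2 * 1) 2 0 σ₁) (hσ₁0 : σ₁ ≠ 0)
    (hline₁ : ∀ c : complexBetti S₁ (2 * 1), IsOfHodgeType 2 S₁ (2 * 1) 2 0 c → ∃ t : ℂ, c = t • σ₁)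
    (hlt : Module.finrank ℂ (complexBetti S₂ (2 * 1)) - Module.finrank ℂ (algebraicClasses S₂ 1) <
      Module.finrank ℂ (complexBetti S₁ (2 * 1)) - Module.finrank ℂ (algebraicClasses S₁ 1))
    (f : complexBetti S₂ (2 * 1) →ₗ[ℂ] complexBetti S₁ (2 * 1))
    (hf₁ : ∀ y, IsRationalClass y → IsRationalClass (f y))
    (hf₂ : ∀ (i j : ℕ) y, IsOfHodgeType 2 S₂ (2 * 1) i j y → IsOfHodgeType 2 S₁ (2 * 1) i j (f y))
    (hf₄ : ∀ y : complexBetti S₂ (2 * 1), ∀ d ∈ algebraicClasses S₁ 1,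
      cupProduct (rfl : 2 * 1 + 2 * 1 = 2 * 2) (f y) d = 0)
    (y : complexBetti S₂ (2 * 1))
    (hy : ∀ d ∈ algebraicClasses S₂ 1, cupProduct (rfl : 2 * 1 + 2 * 1 = 2 * 2) y d = 0) : f y = 0 := by
  haveI : Module.Finite ℚ (bettiCohomology S₁ (2 * 1)) := BettiUniverse.finite h₁ (2 * 1)
  haveI : Module.Finite ℚ (bettiCohomology S₂ (2 * 1)) := BettiUniverse.finite h₂ (2 * 1)
  set M₁ := BettiUniverse.realHodgeModel exists_isReal_hodgeModel_holds h₁ with hM₁def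
  set M₂ := BettiUniverse.realHodgeModel exists_isReal_hodgeModel_holds h₂ with hM₂def
  have hI := hodgePQ_independent_of_hodgeModel_holds
  have h4 : 2 * 1 + 2 * 1 = 2 * 2 := rfl
  -- (1) descend `f` to `g : H²(S₂(ℂ); ℚ) → H²(S₁(ℂ); ℚ)`
  obtain ⟨g, hgofRat, hg⟩ := exists_ratHom_of_isRationalClass f hf₁
  -- (2) `g` is a morphism of Hodge structures `H²_B(S₂) → H²_B(S₁)`
  have hgF : ∀ p : ℤ, ((H²[h₂]).F p).map (g.baseChange ℂ) ≤ (H²[h₁]).F p := by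
    intro p
    rintro _ ⟨x, hx, rfl⟩
    change x ∈ (BettiUniverse.hodge exists_isReal_hodgeModel_holds h₂ (2 * 1)).F p at hx
    change g.baseChange ℂ x ∈ (BettiUniverse.hodge exists_isReal_hodgeModel_holds h₁ (2 * 1)).F p
    rw [BettiUniverse.hodge_F, HodgeModel.ratF_eq_iSup] at hx ⊢
    induction hx using Submodule.iSup_induction' with
    | mem pq x hx =>
      by_cases hp' : p ≤ (pq.1.1 : ℤ)
      · rw [iSup_pos hp'] at hx
        refine Submodule.mem_iSup_of_mem pq (Submodule.mem_iSup_of_mem hp' ?_)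
        rw [HodgeModel.mem_ratPiece_iff, HodgeModel.complexification_apply] at hx ⊢
        have hx1 : IsOfHodgeType 2 S₂ (2 * 1) pq.1.1 pq.1.2 (Θ[S₂] x) := ⟨M₂, hx⟩
        have hx2 := hf₂ _ _ _ hx1
        rw [hg] at hx2
        obtain ⟨B, hB⟩ := hx2
        exact hI 2 S₁ h₁ B M₁ (2 * 1) _ _ _ hB
      · rw [iSup_neg hp', Submodule.mem_bot] at hx
        rw [hx, map_zero]
        exact Submodule.zero_mem _
    | zero => rw [map_zero]; exact Submodule.zero_mem _
    | add x y _ _ hx hy => rw [map_add]; exact Submodule.add_mem _ hx hy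
  let gH : Hom (H²[h₂]) (H²[h₁]) := ⟨g, hgF⟩
  -- (3) `g(H²) ⊆ T(S₁)_ℚ`
  have hN₁ : ∀ h ∈ (H²[h₁]).hodgeClasses 1,
      ofRatClass (Motives.ComplexPoints S₁) (2 * 1) h ∈ algebraicClasses S₁ 1 := fun h hh ↦ by
    rw [← map_hodgeClasses_baseChange_eq_algebraicClasses h₁]
    exact ⟨(1 : ℂ) ⊗ₜ h, Submodule.tmul_mem_baseChange_of_mem 1 hh,
      by rw [ofRatClassBaseChange_tmul, one_smul]⟩
  have hgT : ∀ v, g v ∈ T[h₁] := fun v ↦ by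
    rw [mem_transcendentalLatticeBetti_iff]
    intro h hh
    rw [cupPairingBetti_apply]
    have hc : cupProduct (X := Motives.ComplexPoints S₁) (R := ℚ) h4 h (g v) = 0 := by
      apply ofRatClass_injective (Y := Motives.ComplexPoints S₁) (2 * 2)
      rw [map_zero, ofRatClass_eq_ringChange, singularCohomology.ringChange_cupProduct,
        ← ofRatClass_eq_ringChange, ← ofRatClass_eq_ringChange, hgofRat,
        cupProduct_gradedComm_holds ℂ (Motives.ComplexPoints S₁) h4 h4, hf₄ _ _ (hN₁ h hh), smul_zero]
    rw [hc, map_zero]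
  -- (4) `T(S₁)` is irreducible of larger rank than `T(S₂)`: the restriction vanishes
  obtain ⟨T₁, hT₁, hirr₁, -, -⟩ := exists_transcendental_subHodgeStructure h₁ hσ₁ hσ₁0 hline₁
  obtain ⟨T₂, hT₂⟩ := exists_transcendental_subHodgeStructure' h₂
  have hgT' : ∀ v, g v ∈ T₁.toSubmodule := fun v ↦ by rw [hT₁]; exact hgT v
  let g' : Hom T₂.toHodgeStructure T₁.toHodgeStructure := (gH.comp T₂.subtypeHom).codRestrict T₁ fun t ↦ hgT' _
  have hrk : Module.finrank ℚ T₂.toSubmodule < Module.finrank ℚ T₁.toSubmodule := by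
    rw [hT₁, hT₂, finrank_transcendentalLatticeBetti h₁, finrank_transcendentalLatticeBetti h₂]
    exact hlt
  have hzero := Hom.toLinearMap_eq_zero_of_isIrreducible_of_finrank_lt hirr₁ hrk g'
  have hgq : ∀ t : T₂.toSubmodule, g (t : bettiCohomology S₂ (2 * 1)) = 0 := by
    intro t
    have e1 := LinearMap.congr_fun hzero t
    have e2 : ((g'.toLinearMap t : T₁.toSubmodule) : bettiCohomology S₁ (2 * 1)) = g t := rfl
    rw [← e2, e1, LinearMap.zero_apply, Submodule.coe_zero]
  -- (5) `y ⊥ N¹H²(S₂)` gives `Θ₂⁻¹ y ∈ T(S₂)_ℂ`, killed by `g ⊗ ℂ`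
  obtain ⟨x, rfl⟩ := ofRatClassBaseChange_surjective h₂ (2 * 1) y
  have hxT : x ∈ T₂.toSubmodule.baseChange ℂ := by
    rw [hT₂, transcendentalLatticeBetti, baseChange_orthogonal_eq _ (cupPairingBetti_nondegenerate h₂),
      LinearMap.BilinForm.mem_orthogonal_iff]
    intro z hz
    apply cupPairingBetti_baseChange_eq_zero_of_cup h₂
    rw [cup_baseChange_eq_zero_iff]
    have hzN : Θ[S₂] z ∈ algebraicClasses S₂ 1 := by
      rw [← map_hodgeClasses_baseChange_eq_algebraicClasses h₂]
      exact ⟨z, hz, rfl⟩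
    rw [cupProduct_gradedComm_holds ℂ (Motives.ComplexPoints S₂) h4 h4, hy _ hzN, smul_zero]
  obtain ⟨u, rfl⟩ := hxT
  have hgx : g.baseChange ℂ (T₂.toSubmodule.subtype.baseChange ℂ u) = 0 := by
    clear hy
    induction u using TensorProduct.induction_on with
    | zero => rw [map_zero, map_zero]
    | tmul c t =>
      rw [LinearMap.baseChange_tmul, LinearMap.baseChange_tmul, Submodule.subtype_apply, hgq t,
        TensorProduct.tmul_zero]
    | add u₁ u₂ e₁ e₂ => rw [map_add, map_add, e₁, e₂, add_zero]
  rw [hg, hgx, map_zero]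

/-! ### The Hodge conjecture for `S₁ × S₂` and `S₂ × S₁` -/

/-- **The Hodge conjecture for `S₁ × S₂` when `h^{2,0}(S₁) = 1` and `b₂(S₂) − ρ(S₂) < b₂(S₁) − ρ(S₁)`**,
`S₂` ANY smooth projective complex surface (all codimensions, unconditionally):
`Hom_Hdg(T(S₂), T(S₁)) = 0` (`hom_transcendental_eq_zero_of_lt`) and the gen-47 Künneth bookkeeping
`SurfaceProducts.hodgeConjectureFor_prod_of_hom_transcendental_eq_zero` (no `b₁ = 0` hypothesis).
[cite: Huybrechts2016K3, Ch. 3 Lemma 3.1 and Lemma 3.3] [cite: Huybrechts2019, §1 and Cor. 0.4]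
[cite: VoisinHodgeI2002, §11.3.3 Lemma 11.41] -/
theorem hodgeConjectureFor_prod_of_finrank_lt (h₁ : IsSmoothProjective 2 S₁) (h₂ : IsSmoothProjective 2 S₂)
    {σ₁ : complexBetti S₁ (2 * 1)} (hσ₁ : IsOfHodgeType 2 S₁ (2 * 1) 2 0 σ₁) (hσ₁0 : σ₁ ≠ 0)
    (hline₁ : ∀ c : complexBetti S₁ (2 * 1), IsOfHodgeType 2 S₁ (2 * 1) 2 0 c → ∃ t : ℂ, c = t • σ₁)
    (hlt : Module.finrank ℂ (complexBetti S₂ (2 * 1)) - Module.finrank ℂ (algebraicClasses S₂ 1) <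
      Module.finrank ℂ (complexBetti S₁ (2 * 1)) - Module.finrank ℂ (algebraicClasses S₁ 1)) :
    HodgeConjectureFor 4 (S₁ ⊗ S₂) :=
  SurfaceProducts.hodgeConjectureFor_prod_of_hom_transcendental_eq_zero h₁ h₂
    fun f hf₁ hf₂ _ hf₄ y hy ↦ hom_transcendental_eq_zero_of_lt h₁ h₂ hσ₁ hσ₁0 hline₁ hlt f hf₁ hf₂ hf₄ y hy

/-- **The swapped product**: under the same hypotheses the Hodge conjecture holds for `S₂ × S₁`
(transport along the symmetry `S₂ ⊗ S₁ ≅ S₁ ⊗ S₂`, `CohomologicallyAlgebraic.hodgeConjectureFor_of_iso`).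
[cite: Huybrechts2016K3, Ch. 3 Lemma 3.1 and Lemma 3.3] [cite: VoisinHodgeI2002, §11.3.3 Lemma 11.41] -/
theorem hodgeConjectureFor_prod_of_finrank_lt' (h₁ : IsSmoothProjective 2 S₁) (h₂ : IsSmoothProjective 2 S₂)
    {σ₁ : complexBetti S₁ (2 * 1)} (hσ₁ : IsOfHodgeType 2 S₁ (2 * 1) 2 0 σ₁) (hσ₁0 : σ₁ ≠ 0)
    (hline₁ : ∀ c : complexBetti S₁ (2 * 1), IsOfHodgeType 2 S₁ (2 * 1) 2 0 c → ∃ t : ℂ, c = t • σ₁)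
    (hlt : Module.finrank ℂ (complexBetti S₂ (2 * 1)) - Module.finrank ℂ (algebraicClasses S₂ 1) <
      Module.finrank ℂ (complexBetti S₁ (2 * 1)) - Module.finrank ℂ (algebraicClasses S₁ 1)) :
    HodgeConjectureFor 4 (S₂ ⊗ S₁) := by
  let e : S₂ ⊗ S₁ ≅ S₁ ⊗ S₂ :=
    { hom := lift (snd S₂ S₁) (fst S₂ S₁)
      inv := lift (snd S₁ S₂) (fst S₁ S₂)
      hom_inv_id := by ext <;> simp
      inv_hom_id := by ext <;> simp }
  exact CohomologicallyAlgebraic.hodgeConjectureFor_of_iso e (IsSmoothProjective.tensor_holds h₁ h₂)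
    (IsSmoothProjective.tensor_holds h₂ h₁) (hodgeConjectureFor_prod_of_finrank_lt h₁ h₂ hσ₁ hσ₁0 hline₁ hlt)

/-- **A complex projective K3 surface times any smooth projective surface with a smaller transcendental
lattice**: for `S₁` a K3 surface (`IsK3Surface`) and `S₂` any smooth projective complex surface with
`b₂(S₂) − ρ(S₂) < b₂(S₁) − ρ(S₁)` (e.g., granted `b₂(S₁) = 22`: every abelian, Enriques or rational surface,
every surface with `b₂ − ρ ≤ 21 − ρ(S₁)`), the Hodge conjecture holds for `S₁ × S₂` and `S₂ × S₁`.
[cite: Huybrechts2016K3, Ch. 3 Lemma 3.1 and Ch. 1 (2.7)] [cite: Huybrechts2019, §1] -/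
theorem hodgeConjectureFor_prod_of_isK3Surface_of_finrank_lt (hK₁ : IsK3Surface S₁)
    (h₂ : IsSmoothProjective 2 S₂)
    (hlt : Module.finrank ℂ (complexBetti S₂ (2 * 1)) - Module.finrank ℂ (algebraicClasses S₂ 1) <
      Module.finrank ℂ (complexBetti S₁ (2 * 1)) - Module.finrank ℂ (algebraicClasses S₁ 1)) :
    HodgeConjectureFor 4 (S₁ ⊗ S₂) ∧ HodgeConjectureFor 4 (S₂ ⊗ S₁) := by
  obtain ⟨σ₁, hσ₁0, hσ₁⟩ := hK₁.exists_isOfHodgeType_twoZero_ne_zero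
    (fun E _ _ _ M _ _ ↦ Voisin2002_closedForm_top_zero_not_exact_holds E M)
  exact ⟨hodgeConjectureFor_prod_of_finrank_lt hK₁.isSmoothProjective h₂ hσ₁ hσ₁0
      (hK₁.twoZero_line hσ₁ hσ₁0) hlt,
    hodgeConjectureFor_prod_of_finrank_lt' hK₁.isSmoothProjective h₂ hσ₁ hσ₁0
      (hK₁.twoZero_line hσ₁ hσ₁0) hlt⟩

end Summit.HodgeConjecture.HodgeConjecture.Theorems.OddPrimeSquares

end
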